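import Summits.QuantumAdvantage.QuantumAdvantage.Theorems.CubicForrelationNearExactIsExactTenPartner
import Summits.QuantumAdvantage.QuantumAdvantage.Theorems.CubicForrelationNearExactIsExactAmmCeilingM
import Summits.QuantumAdvantage.QuantumAdvantage.Theorems.CubicForrelationExactPairsMaioranaMcFarlandDefectVanishing

/-!
# Crux `CubicForrelation.NearExactIsExact` (stmt-QuantumAdvantage-14043) — the second digit is an affine CHARACTER on the
split hyperplane (10 bits, `θ = 7/8`)

Seat `b2b-cforr-cert` (n = 10, θ = 7/8 certificate rung), file 3 of the computation-free proof.  HONEST FRAMING: a theorem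
about cubic pairs on 10 bits — NOT summit progress.

Setting as in `TenPartner`: `f, g` cubic on 10 bits, `7/8 < Φ(f,g)`, `W_g = 16u`, `[u odd] = b₀ ⊕ c·x` (`c ≠ 0`), split
hyperplane `L = {u odd}`, and the sign of the second digit `χ(x) := 2[⌊u(x)/2⌋ odd] − 1`.
* `tc_second_deriv`: the quadratic `d₁ = [⌊u/2⌋ odd]` has vanishing second derivatives along `c^⊥`
  (they are constants — `stub_derivDegree` twice — and vanish at a point of `H = Lᶜ`, where `d₁ ≡ 1` by
  `tp_digitOne_of_even` and which is `c^⊥`-invariant); so `χ` restricted to `L = x₀ + c^⊥` is `±` a character of `c^⊥`.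
* `tc_charSum_mem`: hence every character sum `ρ̂(y) := Σ_{x ∈ L} χ(x)(−1)^{x·y}` lies in `{0, ±512}` (a `±1`-character of a
  group sums to `0` or to the group order, `tc_group_charSum`);
* `tc_two_points`: by Parseval (`Σ_y ρ̂(y)² = 2¹⁰·512`) exactly TWO `y` have `ρ̂(y) ≠ 0`, both with `|ρ̂(y)| = 512`;
* `tc_sum_chi`: in particular `Σ_{x∈L} χ(x) ∈ {0, ±512}`.
Paper proof: seat folder `PROOF.md` §2 (2d).  References: C. Carlet, *Boolean Functions for Cryptography and Coding Theory*,
CUP 2021, §2.2 (derivatives, characters).  Axioms: the standard three.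
-/

set_option linter.dupNamespace false -- D-0017: single-problem summit ⇒ `QuantumAdvantage.QuantumAdvantage` by design

noncomputable section

namespace Summit.QuantumAdvantage.QuantumAdvantage.Theorems.CubicForrelation.NearExactIsExact

open Finset
open Literature.Computability.QuantumComplexity
open Literature.Computability.QuantumComplexity.BuzetChailloux (bxor zeroVec signOf_sq twist_zeroVec_right bxor_zeroVec
  bxorPerm bxorPerm_apply bxor_bxor_cancel_left twist_bxor_right)
open Literature.Computability.QuantumComplexity.DerivativeWalsh (W)
open Summit.QuantumAdvantage.QuantumAdvantage.Theorems.SignedExactCubicForrelationNotPrBPP (eq_of_signOf_eq)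
open Summit.QuantumAdvantage.QuantumAdvantage.Theorems.CubicForrelation.ExactPairsMaioranaMcFarland
  (dv_bxor_cancel_right dv_bxor_assoc)

/-! ### Small tools: `±1` values, translation of parities, constants of degree `0` -/

/-- `twist x y ∈ {1, −1}`. [folklore] -/
theorem tc_twist_cases {n : ℕ} (x y : Fin n → Bool) : twist x y = 1 ∨ twist x y = -1 := by
  have h := abs_twist x y
  rcases le_or_gt 0 (twist x y) with h0 | h0
  · left; rwa [abs_of_nonneg h0] at h
  · right; rw [abs_of_neg h0] at h; linarith

/-- Parity transport along `c^⊥`: if `[u odd] = b₀ ⊕ c·x` and `c·v = 0` then `u(x ⊕ v)` and `u(x)` have the same parity.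
[folklore] -/
theorem tc_odd_bxor_iff {n : ℕ} (u : (Fin n → Bool) → ℤ) (c : Fin n → Bool) (b₀ : Bool)
    (hc : ∀ x, signOf (decide (Odd (u x))) = signOf b₀ * twist c x) (x v : Fin n → Bool) (hv : twist c v = 1) :
    Odd (u (bxor x v)) ↔ Odd (u x) := by
  have h : signOf (decide (Odd (u (bxor x v)))) = signOf (decide (Odd (u x))) := by
    rw [hc, hc, twist_bxor_right, hv, mul_one]
  exact decide_eq_decide.mp (eq_of_signOf_eq h)

/-- Parity flip across `L`/`H`: if `[u odd] = b₀ ⊕ c·x` and `c·v = 1` then `u(x ⊕ v)` and `u(x)` have opposite parity.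
[folklore] -/
theorem tc_odd_bxor_iff_not {n : ℕ} (u : (Fin n → Bool) → ℤ) (c : Fin n → Bool) (b₀ : Bool)
    (hc : ∀ x, signOf (decide (Odd (u x))) = signOf b₀ * twist c x) (x v : Fin n → Bool) (hv : twist c v = -1) :
    Odd (u (bxor x v)) ↔ ¬ Odd (u x) := by
  have h : signOf (decide (Odd (u (bxor x v)))) = signOf (!decide (Odd (u x))) := by
    rw [hc, twist_bxor_right, hv, DerivativeWalsh.signOf_not, hc]; ring
  have h' := eq_of_signOf_eq h
  by_cases ho : Odd (u x)
  · simp only [ho, decide_true, Bool.not_true, decide_eq_false_iff_not] at h'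
    simp [ho, h']
  · simp only [ho, decide_false, Bool.not_false, decide_eq_true_eq] at h'
    simp [ho, h']

/-- A Boolean function of algebraic degree `≤ 0` is constant. [cite: Carlet2020, §2.2.1 Def. 6] -/
theorem tc_const_of_deg_zero {n : ℕ} {e : (Fin n → Bool) → Bool} (h : IsDegLeFun 0 e) (x y : Fin n → Bool) :
    e x = e y := by
  obtain ⟨p, hp, he⟩ := h
  have hpC : p = MvPolynomial.C (p.coeff 0) :=
    MvPolynomial.totalDegree_eq_zero_iff_eq_C.mp (Nat.le_zero.mp hp)
  rw [he, he, hpC, polyPhase_C, polyPhase_C]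

/-! ### The second digit is affine on `L` -/

/-- **Vanishing second derivatives of `d₁` along `c^⊥`.** In the setting of `TenPartner` (cubic `f, g` on 10 bits,
`Φ > 7/8`, `W_g = 16u`, `[u odd] = b₀ ⊕ c·x`, `c ≠ 0`): for all `x` and all `v, w` with `c·v = c·w = 0`,
`d₁(x) ⊕ d₁(x⊕v) ⊕ d₁(x⊕w) ⊕ d₁(x⊕v⊕w) = 0`, where `d₁ = [⌊u/2⌋ odd]`. [this work] -/
theorem tc_second_deriv (f g : (Fin (5 + 5) → Bool) → Bool) (hg : IsDegLeFun 3 g)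
    (hΦ : 7 / 8 < forrelation f g) (u : (Fin (5 + 5) → Bool) → ℤ)
    (hu : ∀ x, W (fun y => signOf (g y)) x = (2 : ℝ) ^ 4 * (u x : ℝ)) (c : Fin (5 + 5) → Bool) (b₀ : Bool)
    (hc : ∀ x, signOf (decide (Odd (u x))) = signOf b₀ * twist c x) (hc0 : c ≠ zeroVec)
    (v w : Fin (5 + 5) → Bool) (hv : twist c v = 1) (hw : twist c w = 1) (x : Fin (5 + 5) → Bool) :
    (decide (Odd (u x / 2)) ^^ decide (Odd (u (bxor x v) / 2)) ^^
      (decide (Odd (u (bxor x w) / 2)) ^^ decide (Odd (u (bxor (bxor x w) v) / 2)))) = false := by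
  have hP1 := td_digitOne g u hg hu
  -- the second derivative has degree `≤ 0`, hence is constant
  have hD1 : IsDegLeFun 1 (fun x => decide (Odd (u x / 2)) ^^ decide (Odd (u (bxor x v) / 2))) :=
    stub_derivDegree (5 + 5) 1 (fun x => decide (Odd (u x / 2))) v hP1
  have hD2 : IsDegLeFun 0 (fun x => (decide (Odd (u x / 2)) ^^ decide (Odd (u (bxor x v) / 2))) ^^
      (decide (Odd (u (bxor x w) / 2)) ^^ decide (Odd (u (bxor (bxor x w) v) / 2)))) :=
    stub_derivDegree (5 + 5) 0 _ w hD1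
  -- a point of `H`
  have hH : (univ.filter fun x : Fin (5 + 5) → Bool => ¬ Odd (u x)).Nonempty := by
    rw [← card_pos, tp_card_even u c b₀ hc hc0]; norm_num
  obtain ⟨h₀, hh₀⟩ := hH
  have hh₀ : ¬ Odd (u h₀) := (mem_filter.1 hh₀).2
  have h1 := tp_digitOne_of_even f g hg hΦ u hu c b₀ hc hc0
  have hvw : twist c (bxor w v) = 1 := by rw [twist_bxor_right, hv, hw, mul_one]
  have e1 : decide (Odd (u h₀ / 2)) = true := decide_eq_true (h1 h₀ hh₀)
  have e2 : decide (Odd (u (bxor h₀ v) / 2)) = true :=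
    decide_eq_true (h1 _ (mt (tc_odd_bxor_iff u c b₀ hc h₀ v hv).1 hh₀))
  have e3 : decide (Odd (u (bxor h₀ w) / 2)) = true :=
    decide_eq_true (h1 _ (mt (tc_odd_bxor_iff u c b₀ hc h₀ w hw).1 hh₀))
  have e4 : decide (Odd (u (bxor (bxor h₀ w) v) / 2)) = true := by
    refine decide_eq_true (h1 _ (mt (fun h => ?_) hh₀))
    rw [dv_bxor_assoc] at h
    exact (tc_odd_bxor_iff u c b₀ hc h₀ (bxor w v) hvw).1 h
  refine (tc_const_of_deg_zero hD2 x h₀).trans ?_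
  rw [e1, e2, e3, e4]
  decide

/-! ### Character sums over a group and over the split hyperplane -/

/-- A `±1`-valued multiplicative function on a xor-closed set of bit vectors sums to `0` or to the size of the set.
[folklore] -/
theorem tc_group_charSum {n : ℕ} (V : Finset (Fin n → Bool)) (hV : ∀ v ∈ V, ∀ w ∈ V, bxor v w ∈ V)
    (φ : (Fin n → Bool) → ℝ) (hφ : ∀ v ∈ V, φ v = 1 ∨ φ v = -1)
    (hmul : ∀ v ∈ V, ∀ w ∈ V, φ (bxor v w) = φ v * φ w) :
    ∑ v ∈ V, φ v = 0 ∨ ∑ v ∈ V, φ v = #V := by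
  by_cases hall : ∀ v ∈ V, φ v = 1
  · right
    rw [sum_congr rfl hall, sum_const, nsmul_eq_mul, mul_one]
  · left
    push Not at hall
    obtain ⟨w, hw, hw1⟩ := hall
    have hφw : φ w = -1 := (hφ w hw).resolve_left hw1
    have hre : ∑ v ∈ V, φ v = ∑ v ∈ V, φ (bxor v w) := by
      refine (sum_nbij' (fun v => bxor v w) (fun v => bxor v w) (fun v hv => hV _ hv _ hw)
        (fun v hv => hV _ hv _ hw) (fun v _ => dv_bxor_cancel_right v w) (fun v _ => dv_bxor_cancel_right v w)
        fun v hv => ?_).symm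
      rfl
    rw [sum_congr rfl fun v hv => hmul v hv w hw, ← sum_mul, hφw] at hre
    linarith

/-- The hyperplane `c^⊥ = {v : c·v = 0}` has `512` points on 10 bits when `c ≠ 0`. [folklore] -/
theorem tc_card_perp (c : Fin (5 + 5) → Bool) (hc0 : c ≠ zeroVec) :
    #{v : Fin (5 + 5) → Bool | twist c v = 1} = 512 := by
  have h0 := Simon.sum_twist c
  have hc0' : c ≠ (fun _ => false) := fun h => hc0 (by rw [h]; rfl)
  rw [if_neg hc0'] at h0
  have e : ∀ v : Fin (5 + 5) → Bool, twist c v = 2 * (if twist c v = 1 then (1 : ℝ) else 0) - 1 := by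
    intro v
    rcases tc_twist_cases c v with h | h
    · rw [h]; norm_num
    · rw [h]; norm_num
  rw [sum_congr rfl fun v _ => e v, sum_sub_distrib, ← mul_sum, sum_boole, sum_const, card_univ, Fintype.card_fun,
    Fintype.card_bool, Fintype.card_fin] at h0
  norm_num at h0
  have : (#{v : Fin (5 + 5) → Bool | twist c v = 1} : ℝ) = 512 := by linarith
  exact_mod_cast this

/-- The sign of the second digit, `χ(x) = 2[⌊u(x)/2⌋ odd] − 1 ∈ {±1}` (real-valued). [this work] -/
def chiR (u : (Fin (5 + 5) → Bool) → ℤ) (x : Fin (5 + 5) → Bool) : ℝ := if Odd (u x / 2) then 1 else -1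

/-- `χ` takes the values `±1`. [folklore] -/
theorem tc_chiR_cases (u : (Fin (5 + 5) → Bool) → ℤ) (x : Fin (5 + 5) → Bool) : chiR u x = 1 ∨ chiR u x = -1 := by
  unfold chiR; split_ifs <;> simp

/-- `χ(x)² = 1`. [folklore] -/
theorem tc_chiR_sq (u : (Fin (5 + 5) → Bool) → ℤ) (x : Fin (5 + 5) → Bool) : chiR u x * chiR u x = 1 := by
  rcases tc_chiR_cases u x with h | h <;> rw [h] <;> norm_num

/-- `χ = −(−1)^{d₁}`. [folklore] -/
theorem tc_chiR_eq (u : (Fin (5 + 5) → Bool) → ℤ) (x : Fin (5 + 5) → Bool) :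
    chiR u x = -signOf (decide (Odd (u x / 2))) := by
  unfold chiR signOf
  by_cases h : Odd (u x / 2) <;> simp [h]

/-- The character table `ρ(x) := [x ∈ L]·χ(x)` whose Walsh transform is `ρ̂(y) = Σ_{x∈L} χ(x)(−1)^{x·y}`. [this work] -/
def rhoR (u : (Fin (5 + 5) → Bool) → ℤ) (x : Fin (5 + 5) → Bool) : ℝ := if Odd (u x) then chiR u x else 0

/-- `ρ̂(y)` is the sum of `χ(x)(−1)^{x·y}` over the split hyperplane `L`. [folklore] -/
theorem tc_W_rhoR (u : (Fin (5 + 5) → Bool) → ℤ) (y : Fin (5 + 5) → Bool) :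
    W (rhoR u) y = ∑ x ∈ univ.filter (fun x => Odd (u x)), chiR u x * twist x y := by
  rw [W, sum_filter]
  refine sum_congr rfl fun x _ => ?_
  unfold rhoR; split_ifs <;> simp

/-- **Every character sum of `χ` over `L` is `0` or `±512`.** [this work] -/
theorem tc_charSum_mem (f g : (Fin (5 + 5) → Bool) → Bool) (hg : IsDegLeFun 3 g)
    (hΦ : 7 / 8 < forrelation f g) (u : (Fin (5 + 5) → Bool) → ℤ)
    (hu : ∀ x, W (fun y => signOf (g y)) x = (2 : ℝ) ^ 4 * (u x : ℝ)) (c : Fin (5 + 5) → Bool) (b₀ : Bool)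
    (hc : ∀ x, signOf (decide (Odd (u x))) = signOf b₀ * twist c x) (hc0 : c ≠ zeroVec) (y : Fin (5 + 5) → Bool) :
    W (rhoR u) y = 0 ∨ W (rhoR u) y = 512 ∨ W (rhoR u) y = -512 := by
  -- a base point of `L`
  have hL : (univ.filter fun x : Fin (5 + 5) → Bool => decide (Odd (u x)) = true).Nonempty := by
    rw [← card_pos, tp_card_odd u c b₀ hc hc0]; norm_num
  obtain ⟨x₀, hx₀⟩ := hL
  have hx₀ : Odd (u x₀) := of_decide_eq_true (mem_filter.1 hx₀).2
  have hVmem : ∀ v, v ∈ univ.filter (fun v : Fin (5 + 5) → Bool => twist c v = 1) ↔ twist c v = 1 :=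
    fun v => by simp
  have hVcl : ∀ v ∈ univ.filter (fun v : Fin (5 + 5) → Bool => twist c v = 1),
      ∀ w ∈ univ.filter (fun v : Fin (5 + 5) → Bool => twist c v = 1),
      bxor v w ∈ univ.filter (fun v : Fin (5 + 5) → Bool => twist c v = 1) := fun v hv w hw => by
    rw [hVmem] at hv hw ⊢; rw [twist_bxor_right, hv, hw, mul_one]
  -- reindex `L = x₀ ⊕ V`
  have hre : W (rhoR u) y = chiR u x₀ * twist x₀ y *
      ∑ v ∈ univ.filter (fun v => twist c v = 1), (chiR u (bxor x₀ v) * chiR u x₀) * twist v y := by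
    rw [tc_W_rhoR, sum_filter, ← Equiv.sum_comp (bxorPerm x₀), mul_sum, sum_filter]
    refine sum_congr rfl fun v _ => ?_
    simp only [bxorPerm_apply]
    have hpar : Odd (u (bxor x₀ v)) ↔ twist c v = 1 := by
      rcases tc_twist_cases c v with h | h
      · exact ⟨fun _ => h, fun _ => (tc_odd_bxor_iff u c b₀ hc x₀ v h).2 hx₀⟩
      · constructor
        · intro ho; exact absurd ((tc_odd_bxor_iff_not u c b₀ hc x₀ v h).1 ho) (not_not.2 hx₀)
        · intro h1; rw [h] at h1; norm_num at h1
    by_cases hv : twist c v = 1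
    · rw [if_pos (hpar.2 hv), if_pos hv, acm_twist_bxor_left]
      have s0 := tc_chiR_sq u x₀
      linear_combination (-(chiR u (bxor x₀ v)) * twist x₀ y * twist v y) * s0
    · simp only [if_neg (mt hpar.1 hv), if_neg hv]
  -- the summand is a `±1` character of `V = c^⊥`
  have hφ : ∀ v ∈ univ.filter (fun v => twist c v = 1),
      chiR u (bxor x₀ v) * chiR u x₀ * twist v y = 1 ∨ chiR u (bxor x₀ v) * chiR u x₀ * twist v y = -1 := by
    intro v _
    rcases tc_chiR_cases u (bxor x₀ v) with h1 | h1 <;> rcases tc_chiR_cases u x₀ with h2 | h2 <;>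
      rcases tc_twist_cases v y with h3 | h3 <;> simp [h1, h2, h3]
  have hmul : ∀ v ∈ univ.filter (fun v => twist c v = 1), ∀ w ∈ univ.filter (fun v => twist c v = 1),
      chiR u (bxor x₀ (bxor v w)) * chiR u x₀ * twist (bxor v w) y =
      (chiR u (bxor x₀ v) * chiR u x₀ * twist v y) * (chiR u (bxor x₀ w) * chiR u x₀ * twist w y) := by
    intro v hv w hw
    have h4 := tc_second_deriv f g hg hΦ u hu c b₀ hc hc0 v w ((hVmem v).1 hv) ((hVmem w).1 hw) x₀
    -- translate the vanishing 4-fold xor into a product of signs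
    have hprod : chiR u x₀ * chiR u (bxor x₀ v) * (chiR u (bxor x₀ w) * chiR u (bxor (bxor x₀ w) v)) = 1 := by
      rw [tc_chiR_eq, tc_chiR_eq, tc_chiR_eq, tc_chiR_eq]
      have e : ∀ a b c d : Bool, (a ^^ b ^^ (c ^^ d)) = false →
          -signOf a * -signOf b * (-signOf c * -signOf d) = 1 := by
        intro a b c d
        cases a <;> cases b <;> cases c <;> cases d <;> simp [signOf]
      exact e _ _ _ _ h4
    rw [show bxor x₀ (bxor v w) = bxor (bxor x₀ w) v by
      rw [dv_bxor_assoc, BuzetChailloux.bxor_comm w v], acm_twist_bxor_left]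
    have s3 := tc_chiR_sq u (bxor (bxor x₀ w) v)
    linear_combination (-(chiR u x₀) * twist v y * twist w y * chiR u (bxor (bxor x₀ w) v)) * hprod +
      (chiR u x₀ * chiR u x₀ * chiR u (bxor x₀ v) * chiR u (bxor x₀ w) * twist v y * twist w y) * s3
  have hsum := tc_group_charSum _ hVcl _ hφ hmul
  have hV : (#(univ.filter (fun v : Fin (5 + 5) → Bool => twist c v = 1)) : ℝ) = 512 := by
    rw [tc_card_perp c hc0]; norm_num
  rw [hre]
  rcases hsum with h | h
  · left; rw [h, mul_zero]
  · rw [h, hV]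
    rcases tc_chiR_cases u x₀ with h1 | h1 <;> rcases tc_twist_cases x₀ y with h2 | h2 <;> simp [h1, h2]

/-- Parseval for `ρ`: `Σ_y ρ̂(y)² = 2¹⁰ · 512`. [folklore] -/
theorem tc_rho_parseval (u : (Fin (5 + 5) → Bool) → ℤ) (c : Fin (5 + 5) → Bool) (b₀ : Bool)
    (hc : ∀ x, signOf (decide (Odd (u x))) = signOf b₀ * twist c x) (hc0 : c ≠ zeroVec) :
    ∑ y, W (rhoR u) y ^ 2 = (2 : ℝ) ^ 10 * 512 := by
  have h := tb_sum_W_sq_mul_twist (rhoR u) zeroVec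
  simp only [twist_zeroVec_right, mul_one, bxor_zeroVec] at h
  rw [h]
  congr 1
  have e : ∀ y : Fin (5 + 5) → Bool, rhoR u y * rhoR u y = if Odd (u y) then 1 else 0 := by
    intro y; unfold rhoR; split_ifs with hy
    · exact tc_chiR_sq u y
    · simp
  rw [sum_congr rfl fun y _ => e y, sum_boole]
  have hL := tp_card_odd u c b₀ hc hc0
  have e2 : (univ.filter fun x : Fin (5 + 5) → Bool => Odd (u x)) =
      univ.filter fun x : Fin (5 + 5) → Bool => decide (Odd (u x)) = true := by ext x; simp
  rw [e2, hL]; norm_num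

/-- **Two-point support.** In the setting of `TenPartner`, the character sums `ρ̂(y) = Σ_{x∈L} χ(x)(−1)^{x·y}` vanish
except at exactly two points, where they equal `±512`. [this work] -/
theorem tc_two_points (f g : (Fin (5 + 5) → Bool) → Bool) (hg : IsDegLeFun 3 g)
    (hΦ : 7 / 8 < forrelation f g) (u : (Fin (5 + 5) → Bool) → ℤ)
    (hu : ∀ x, W (fun y => signOf (g y)) x = (2 : ℝ) ^ 4 * (u x : ℝ)) (c : Fin (5 + 5) → Bool) (b₀ : Bool)
    (hc : ∀ x, signOf (decide (Odd (u x))) = signOf b₀ * twist c x) (hc0 : c ≠ zeroVec) :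
    ∃ y₁ y₂ : Fin (5 + 5) → Bool, y₁ ≠ y₂ ∧ |W (rhoR u) y₁| = 512 ∧ |W (rhoR u) y₂| = 512 ∧
      ∀ y, y ≠ y₁ → y ≠ y₂ → W (rhoR u) y = 0 := by
  classical
  have hmem := tc_charSum_mem f g hg hΦ u hu c b₀ hc hc0
  have hpar := tc_rho_parseval u c b₀ hc hc0
  have hsq : ∀ y, W (rhoR u) y ^ 2 = if W (rhoR u) y ≠ 0 then (512 : ℝ) ^ 2 else 0 := by
    intro y
    rcases hmem y with h | h | h
    · simp [h]
    · rw [if_pos (by rw [h]; norm_num), h]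
    · rw [if_pos (by rw [h]; norm_num), h]; norm_num
  rw [sum_congr rfl fun y _ => hsq y, ← sum_filter, sum_const] at hpar
  have hcard : #(univ.filter fun y : Fin (5 + 5) → Bool => W (rhoR u) y ≠ 0) = 2 := by
    have : (#(univ.filter fun y : Fin (5 + 5) → Bool => W (rhoR u) y ≠ 0) : ℝ) * 512 ^ 2 = 2 ^ 10 * 512 := by
      rw [← hpar, nsmul_eq_mul]
    have : (#(univ.filter fun y : Fin (5 + 5) → Bool => W (rhoR u) y ≠ 0) : ℝ) = 2 := by nlinarith
    exact_mod_cast this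
  obtain ⟨y₁, y₂, hne, hS⟩ := card_eq_two.1 hcard
  have hy₁ : y₁ ∈ (univ.filter fun y : Fin (5 + 5) → Bool => W (rhoR u) y ≠ 0) := by rw [hS]; simp
  have hy₂ : y₂ ∈ (univ.filter fun y : Fin (5 + 5) → Bool => W (rhoR u) y ≠ 0) := by rw [hS]; simp
  have habs : ∀ y ∈ (univ.filter fun y : Fin (5 + 5) → Bool => W (rhoR u) y ≠ 0), |W (rhoR u) y| = 512 := by
    intro y hy
    have hy' : W (rhoR u) y ≠ 0 := (mem_filter.1 hy).2
    rcases hmem y with h | h | h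
    · exact absurd h hy'
    · rw [h]; norm_num
    · rw [h]; norm_num
  refine ⟨y₁, y₂, hne, habs y₁ hy₁, habs y₂ hy₂, fun y h1 h2 => ?_⟩
  by_contra hy
  have : y ∈ (univ.filter fun y : Fin (5 + 5) → Bool => W (rhoR u) y ≠ 0) := mem_filter.2 ⟨mem_univ _, hy⟩
  rw [hS] at this
  simp only [mem_insert, mem_singleton] at this
  rcases this with h | h
  · exact h1 h
  · exact h2 h

/-- **The plain sum of `χ` over `L` is `0` or `±512`.** [this work] -/
theorem tc_sum_chi (f g : (Fin (5 + 5) → Bool) → Bool) (hg : IsDegLeFun 3 g)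
    (hΦ : 7 / 8 < forrelation f g) (u : (Fin (5 + 5) → Bool) → ℤ)
    (hu : ∀ x, W (fun y => signOf (g y)) x = (2 : ℝ) ^ 4 * (u x : ℝ)) (c : Fin (5 + 5) → Bool) (b₀ : Bool)
    (hc : ∀ x, signOf (decide (Odd (u x))) = signOf b₀ * twist c x) (hc0 : c ≠ zeroVec) :
    ∑ x ∈ univ.filter (fun x => Odd (u x)), chiR u x = 0 ∨ ∑ x ∈ univ.filter (fun x => Odd (u x)), chiR u x = 512 ∨
      ∑ x ∈ univ.filter (fun x => Odd (u x)), chiR u x = -512 := by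
  have h := tc_charSum_mem f g hg hΦ u hu c b₀ hc hc0 zeroVec
  rw [tc_W_rhoR] at h
  simpa only [twist_zeroVec_right, mul_one] using h

end Summit.QuantumAdvantage.QuantumAdvantage.Theorems.CubicForrelation.NearExactIsExact

end
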